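import Mathlib.Analysis.SpecialFunctions.Pow.Continuity
import Mathlib.Analysis.SpecificLimits.Basic
import Mathlib.Order.Filter.AtTopBot.Archimedean
import Summits.CriticalPhenomena.Ising3DConformalLimit.Theorems.ExistsScaleCovariantLimit.Negative.DyadicTwoPrimesDensity
import Literature.Probability.LatticeModels.PointwiseScalingLimitEtaExists
import Literature.Probability.LatticeModels.CriticalAxisRatioRegularity
import HarnessLib

/-!
# Crux `IsingEuclidUpgradeR2RotInvPowerLaw` (stmt-CriticalPhenomena-0634), line `tower_profile_rigidity`:
# TWO DILATIONS SUFFICE — the integer dilation law S2 from the dyadic law (item 6323) and its triadic twin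

Write `G := criticalTwoPoint 3` for the critical two-point function `⟨σ₀σ_x⟩_{β_c}` of the nearest-neighbour
Ising model on `ℤ³` and `g(n) := G(n e₀)`. The registered stub S2 `stub_integerDilationLaw` of the line is
`∃ Δ ∀ k ≥ 1, g(kn)·k^{2Δ}/g(n) → 1` (regular variation of `g` along every integer dilation; OPEN — its
`k = 2` case is the open item stmt-CriticalPhenomena-6323). This file proves the registered glue
`integerDilationLaw_of_dyadicScalingLaw_of_triadicScalingLaw : DyadicScalingLaw → (triadic twin) → S2`,
whose first hypothesis is verbatim item stmt-CriticalPhenomena-6323 `Theses.ThresholdDilation.DyadicScalingLaw`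
(`∃ Δ > 0, g(2n)·4^Δ/g(n) → 1`) and whose second is its triadic twin `∃ Δ', g(3n)·9^{Δ'}/g(n) → 1`. Reading
for planners: S2 costs exactly item 6323 plus ONE more rate-free number (and 6323 alone does not give S2 — a
`log 2`-periodic modulation of `g` survives, cf. `not_twoBaseCroftWithoutThree`).

Proof: W. Feller, *An Introduction to Probability Theory and Its Applications* II (1971), §VIII.8 Lemma 1,
Theorem and Lemma 3 ("a monotone `U` varies regularly at `∞` iff `U(tx)/U(t)` converges on a dense set of
`x`"), in sequence form, the dense set being the group `{2^a 3^b : a, b ∈ ℤ}` (Kronecker; landed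
`exists_seq_two_three_tendsto`). Real-variable core = namespace `TwoDilations`, for an abstract `g > 0`,
antitone, with `g(n+1)/g(n) → 1`, the law at `p` being used in RATIO FORM `D(p) : g(pn)/g(n) → p^{-2Δ}`:
`D(p) ∧ D(q) ⇒ D(pq)` (compose along `n ↦ qn`), whence `D(2^a 3^b)`; given `k ≥ 1` and `A < k^{-2Δ} < B`,
density and continuity of `x ↦ x^{-2Δ}` give semigroup elements with `p/q ∈ (k, k+δ)`, `(p/q)^{-2Δ} > A`;
with `m := ⌊n/q⌋ → ∞` one has `qm ≤ n < q(m+1)` and `kn ≤ p(m+1)`, so by antitonicity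
`g(kn)/g(n) ≥ g(p(m+1))/g(qm) = [g(p(m+1))/g(m)]/[g(qm)/g(m)] → (p/q)^{-2Δ} > A` (the `±1` shifts are
absorbed by `g(m+1)/g(m) → 1`), and symmetrically from above (`TwoDilations.integerDilation_of_two_three`).
The two exponents are forced equal (`TwoDilations.exponent_unique`): the `D`-limits along `2^a ≤ 3^b` and
antitonicity give `Δ₂ a log 2 ≤ Δ₃ b log 3`, along `3^b ≤ 2^a` the reverse; take rationals `a/b` on either
side of `log 3 / log 2`. Tree inputs: `criticalTwoPoint_axis_pos`, `criticalTwoPoint_axis_antitone`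
(Messager–Miracle-Solé), `criticalTwoPoint_axis_ratio_tendsto_one'`, `exists_seq_two_three_tendsto`.
No definition is introduced; S2 itself is NOT proved here.
-/

noncomputable section

namespace Summit.CriticalPhenomena.Ising3DConformalLimit.Cruxes.IsingEuclidUpgradeR2RotInvPowerLaw.TowerProfileRigidity

/-! ## Real-variable core: ratio-form dilation laws of a positive antitone sequence -/

namespace TwoDilations

open Filter Topology

variable {g : ℕ → ℝ} {Δ : ℝ}

/-- The ratio-form law at `p = 1` is trivial: `g(1·n)/g(n) = 1 = 1^{-2Δ}`. -/
theorem dil_one (hpos : ∀ n, 0 < g n) :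
    Tendsto (fun n : ℕ => g (1 * n) / g n) atTop (𝓝 (((1 : ℕ) : ℝ) ^ (-(2 * Δ)))) := by
  simp only [Nat.cast_one, Real.one_rpow, one_mul]
  exact tendsto_const_nhds.congr fun n => (div_self (hpos n).ne').symm

/-- From the `S2`-shaped law `g(pn)·p^{2Δ}/g(n) → 1` to the ratio form `g(pn)/g(n) → p^{-2Δ}`. -/
theorem dil_of_law {p : ℕ} (hp : 0 < p)
    (h : Tendsto (fun n : ℕ => g (p * n) * (p : ℝ) ^ (2 * Δ) / g n) atTop (𝓝 1)) :
    Tendsto (fun n : ℕ => g (p * n) / g n) atTop (𝓝 ((p : ℝ) ^ (-(2 * Δ)))) := by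
  have hp' : (0 : ℝ) < p := by exact_mod_cast hp
  have hne : (p : ℝ) ^ (2 * Δ) ≠ 0 := (Real.rpow_pos_of_pos hp' _).ne'
  have := h.mul_const ((p : ℝ) ^ (-(2 * Δ)))
  rw [one_mul] at this
  refine this.congr fun n => ?_
  rw [Real.rpow_neg hp'.le, div_mul_eq_mul_div, mul_assoc, mul_inv_cancel₀ hne, mul_one]

/-- Ratio-form laws multiply: `p` and `q` give `p * q` (compose the law at `p` along `n ↦ qn`). -/
theorem dil_mul {p q : ℕ} (hq : 0 < q)
    (hp : Tendsto (fun n : ℕ => g (p * n) / g n) atTop (𝓝 ((p : ℝ) ^ (-(2 * Δ)))))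
    (hQ : Tendsto (fun n : ℕ => g (q * n) / g n) atTop (𝓝 ((q : ℝ) ^ (-(2 * Δ)))))
    (hpos : ∀ n, 0 < g n) :
    Tendsto (fun n : ℕ => g (p * q * n) / g n) atTop (𝓝 (((p * q : ℕ) : ℝ) ^ (-(2 * Δ)))) := by
  have key : Tendsto (fun n : ℕ => g (p * (q * n)) / g (q * n) * (g (q * n) / g n)) atTop
      (𝓝 ((p : ℝ) ^ (-(2 * Δ)) * (q : ℝ) ^ (-(2 * Δ)))) :=
    (hp.comp (tendsto_id.const_mul_atTop' hq)).mul hQ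
  rw [← Real.mul_rpow (Nat.cast_nonneg p) (Nat.cast_nonneg q)] at key
  push_cast
  refine key.congr fun n => ?_
  have h1 := (hpos (q * n)).ne'
  have h2 := (hpos n).ne'
  rw [Nat.mul_assoc]
  field_simp

/-- Ratio-form laws iterate: the law at `p` gives the law at every power `p ^ a`. -/
theorem dil_pow (hpos : ∀ n, 0 < g n) {p : ℕ} (hp : 0 < p)
    (hD : Tendsto (fun n : ℕ => g (p * n) / g n) atTop (𝓝 ((p : ℝ) ^ (-(2 * Δ))))) (a : ℕ) :
    Tendsto (fun n : ℕ => g (p ^ a * n) / g n) atTop (𝓝 (((p ^ a : ℕ) : ℝ) ^ (-(2 * Δ)))) := by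
  induction a with
  | zero => simpa using dil_one (Δ := Δ) hpos
  | succ a ih =>
    rw [pow_succ']
    have := dil_mul (pow_pos hp a) hD (by exact_mod_cast ih) hpos
    exact_mod_cast this

/-- The ratio-form laws at `2` and at `3` (same exponent) give the law on the whole semigroup `2^a 3^b`. -/
theorem dil_two_pow_three_pow (hpos : ∀ n, 0 < g n)
    (h2 : Tendsto (fun n : ℕ => g (2 * n) / g n) atTop (𝓝 (((2 : ℕ) : ℝ) ^ (-(2 * Δ)))))
    (h3 : Tendsto (fun n : ℕ => g (3 * n) / g n) atTop (𝓝 (((3 : ℕ) : ℝ) ^ (-(2 * Δ)))))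
    (a b : ℕ) :
    Tendsto (fun n : ℕ => g (2 ^ a * 3 ^ b * n) / g n) atTop
      (𝓝 (((2 ^ a * 3 ^ b : ℕ) : ℝ) ^ (-(2 * Δ)))) :=
  dil_mul (pow_pos three_pos b) (dil_pow hpos two_pos h2 a) (dil_pow hpos three_pos h3 b) hpos

/-- `g(p(m+1))/g(m) → p^{-2Δ}` (uses the unit-step ratio `g(m+1)/g(m) → 1`). -/
theorem dil_succ {p : ℕ}
    (hp : Tendsto (fun n : ℕ => g (p * n) / g n) atTop (𝓝 ((p : ℝ) ^ (-(2 * Δ)))))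
    (hratio : Tendsto (fun n : ℕ => g (n + 1) / g n) atTop (𝓝 1)) (hpos : ∀ n, 0 < g n) :
    Tendsto (fun m : ℕ => g (p * (m + 1)) / g m) atTop (𝓝 ((p : ℝ) ^ (-(2 * Δ)))) := by
  have h1 : Tendsto (fun m : ℕ => g (p * (m + 1)) / g (m + 1)) atTop (𝓝 ((p : ℝ) ^ (-(2 * Δ)))) :=
    hp.comp (tendsto_add_atTop_nat 1)
  have := h1.mul hratio
  rw [mul_one] at this
  refine this.congr fun m => ?_
  have := (hpos (m + 1)).ne'
  have := (hpos m).ne'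
  field_simp

/-- `g(pm)/g(m+1) → p^{-2Δ}` (uses the unit-step ratio `g(m+1)/g(m) → 1`). -/
theorem dil_pred {p : ℕ}
    (hp : Tendsto (fun n : ℕ => g (p * n) / g n) atTop (𝓝 ((p : ℝ) ^ (-(2 * Δ)))))
    (hratio : Tendsto (fun n : ℕ => g (n + 1) / g n) atTop (𝓝 1)) (hpos : ∀ n, 0 < g n) :
    Tendsto (fun m : ℕ => g (p * m) / g (m + 1)) atTop (𝓝 ((p : ℝ) ^ (-(2 * Δ)))) := by
  have hinv : Tendsto (fun n : ℕ => g n / g (n + 1)) atTop (𝓝 1) := by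
    have := hratio.inv₀ one_ne_zero
    rw [inv_one] at this
    exact this.congr fun n => by rw [inv_div]
  have := hp.mul hinv
  rw [mul_one] at this
  refine this.congr fun m => ?_
  have := (hpos (m + 1)).ne'
  have := (hpos m).ne'
  field_simp

open Summit.CriticalPhenomena.Ising3DConformalLimit.ExistsScaleCovariantLimitNegative.Dyadic in
/-- Kronecker input (landed `exists_seq_two_three_tendsto`): every interval of positive reals contains
a ratio of two elements of the semigroup `{2^a 3^b : a, b ∈ ℕ}`. [folklore] -/
theorem exists_two_three_ratio_mem {lo hi : ℝ} (hlo : 0 < lo) (hlt : lo < hi) :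
    ∃ a b a' b' : ℕ, lo < ((2 ^ a * 3 ^ b : ℕ) : ℝ) / ((2 ^ a' * 3 ^ b' : ℕ) : ℝ) ∧
      ((2 ^ a * 3 ^ b : ℕ) : ℝ) / ((2 ^ a' * 3 ^ b' : ℕ) : ℝ) < hi := by
  have hc : 0 < (lo + hi) / 2 := by linarith
  obtain ⟨u, hu⟩ := exists_seq_two_three_tendsto hc
  have hev : ∀ᶠ j in atTop, lo < (2:ℝ) ^ (u j).1 * (3:ℝ) ^ (u j).2 ∧
      (2:ℝ) ^ (u j).1 * (3:ℝ) ^ (u j).2 < hi :=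
    (hu.eventually (lt_mem_nhds (by linarith))).and (hu.eventually (gt_mem_nhds (by linarith)))
  obtain ⟨j, hj1, hj2⟩ := hev.exists
  refine ⟨(u j).1.toNat, (u j).2.toNat, (-(u j).1).toNat, (-(u j).2).toNat, ?_⟩
  have hz : ∀ {x : ℝ}, x ≠ 0 → ∀ e : ℤ, x ^ e = x ^ e.toNat / x ^ (-e).toNat := fun hx e => by
    conv_lhs => rw [← Int.toNat_sub_toNat_neg e]
    rw [zpow_sub₀ hx, zpow_natCast, zpow_natCast]
  have key : ((2 ^ (u j).1.toNat * 3 ^ (u j).2.toNat : ℕ) : ℝ) /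
      ((2 ^ (-(u j).1).toNat * 3 ^ (-(u j).2).toNat : ℕ) : ℝ) = (2:ℝ) ^ (u j).1 * (3:ℝ) ^ (u j).2 := by
    rw [hz two_ne_zero, hz (by norm_num : (3:ℝ) ≠ 0)]
    push_cast
    rw [div_mul_div_comm]
  rw [key]; exact ⟨hj1, hj2⟩

/-- **Two dilations suffice.** A positive antitone sequence with unit-step ratios `→ 1` obeying the
rate-free dilation law at `k = 2` and at `k = 3` with the same exponent `Δ` obeys it at every `k ≥ 1`
(conclusion = the integer dilation law S2 at `Δ` for `g n = ⟨σ₀σ_{ne₀}⟩`). Sequence form of Feller's lemma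
"a monotone function varies regularly iff its dilation ratios converge on a dense set", the dense set being
the ratios of `{2^a 3^b}`. [cite: Feller1971, §VIII.8 Lemma 1] -/
theorem integerDilation_of_two_three (hpos : ∀ n, 0 < g n) (hanti : Antitone g)
    (hratio : Tendsto (fun n : ℕ => g (n + 1) / g n) atTop (𝓝 1))
    (h2 : Tendsto (fun n : ℕ => g (2 * n) * (2 : ℝ) ^ (2 * Δ) / g n) atTop (𝓝 1))
    (h3 : Tendsto (fun n : ℕ => g (3 * n) * (3 : ℝ) ^ (2 * Δ) / g n) atTop (𝓝 1)) :
    ∀ k : ℕ, 1 ≤ k →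
      Tendsto (fun n : ℕ => g (k * n) * (k : ℝ) ^ (2 * Δ) / g n) atTop (𝓝 1) := by
  have hD2 := dil_of_law (g := g) (Δ := Δ) two_pos (by exact_mod_cast h2)
  have hD3 := dil_of_law (g := g) (Δ := Δ) three_pos (by exact_mod_cast h3)
  have hP : ∀ a b : ℕ, Tendsto (fun n : ℕ => g (2 ^ a * 3 ^ b * n) / g n) atTop
      (𝓝 (((2 ^ a * 3 ^ b : ℕ) : ℝ) ^ (-(2 * Δ)))) := dil_two_pow_three_pow hpos hD2 hD3
  intro k hk
  have hk0 : (0 : ℝ) < k := by exact_mod_cast hk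
  have hkne : (k : ℝ) ^ (2 * Δ) ≠ 0 := (Real.rpow_pos_of_pos hk0 _).ne'
  -- reduce to the ratio form `g(kn)/g(n) → k^{-2Δ}`
  suffices hr : Tendsto (fun n : ℕ => g (k * n) / g n) atTop (𝓝 ((k : ℝ) ^ (-(2 * Δ)))) by
    have := hr.mul_const ((k : ℝ) ^ (2 * Δ))
    rw [Real.rpow_neg hk0.le, inv_mul_cancel₀ hkne] at this
    refine this.congr fun n => ?_
    rw [div_mul_eq_mul_div]
  have hcont : ContinuousAt (fun x : ℝ => x ^ (-(2 * Δ))) k :=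
    Real.continuousAt_rpow_const _ _ (Or.inl hk0.ne')
  rw [tendsto_order]
  constructor
  · -- lower bound: squeeze from a ratio `p/q ∈ (k, k+δ)`
    intro A hA
    obtain ⟨δ, hδ, hAδ⟩ := Metric.eventually_nhds_iff.1 (hcont.eventually (lt_mem_nhds hA))
    obtain ⟨a, b, a', b', hlo, hhi⟩ :=
      exists_two_three_ratio_mem hk0 (show (k : ℝ) < k + δ by linarith)
    set p : ℕ := 2 ^ a * 3 ^ b with hp_def
    set q : ℕ := 2 ^ a' * 3 ^ b' with hq_def
    have hq0 : 0 < q := by positivity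
    have hq0' : (0 : ℝ) < q := by exact_mod_cast hq0
    have hApq : A < ((p : ℝ) / q) ^ (-(2 * Δ)) :=
      hAδ (by rw [Real.dist_eq, abs_lt]; constructor <;> linarith)
    have hkq : k * q ≤ p := by
      have : (k : ℝ) * q < p := by rwa [lt_div_iff₀ hq0'] at hlo
      exact_mod_cast this.le
    have hlim : Tendsto (fun m : ℕ => g (p * (m + 1)) / g m / (g (q * m) / g m)) atTop
        (𝓝 (((p : ℝ) / q) ^ (-(2 * Δ)))) := by
      rw [Real.div_rpow (Nat.cast_nonneg p) (Nat.cast_nonneg q)]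
      exact (dil_succ (hP a b) hratio hpos).div (hP a' b') (Real.rpow_pos_of_pos hq0' _).ne'
    have hev : ∀ᶠ n : ℕ in atTop,
        A < g (p * (n / q + 1)) / g (n / q) / (g (q * (n / q)) / g (n / q)) :=
      (hlim.comp (Nat.tendsto_div_const_atTop hq0.ne')).eventually (lt_mem_nhds hApq)
    filter_upwards [hev] with n hn
    rw [div_div_div_cancel_right₀ (hpos _).ne'] at hn
    refine lt_of_lt_of_le hn
      (div_le_div₀ (hpos _).le (hanti ?_) (hpos _) (hanti (Nat.mul_div_le n q)))
    calc k * n ≤ k * (q * (n / q + 1)) := Nat.mul_le_mul_left k (Nat.lt_mul_div_succ n hq0).le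
      _ = (k * q) * (n / q + 1) := by ring
      _ ≤ p * (n / q + 1) := Nat.mul_le_mul_right _ hkq
  · -- upper bound: squeeze from a ratio `p/q ∈ (k-δ', k)`
    intro B hB
    obtain ⟨δ, hδ, hBδ⟩ := Metric.eventually_nhds_iff.1 (hcont.eventually (gt_mem_nhds hB))
    have hlo0 : 0 < (k : ℝ) - min δ (k / 2) := by
      have := min_le_right δ ((k : ℝ) / 2); linarith
    have hlo1 : (k : ℝ) - min δ (k / 2) < k := by
      have := lt_min hδ (half_pos hk0); linarith
    obtain ⟨a, b, a', b', hlo, hhi⟩ := exists_two_three_ratio_mem hlo0 hlo1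
    set p : ℕ := 2 ^ a * 3 ^ b with hp_def
    set q : ℕ := 2 ^ a' * 3 ^ b' with hq_def
    have hq0 : 0 < q := by positivity
    have hq0' : (0 : ℝ) < q := by exact_mod_cast hq0
    have hBpq : ((p : ℝ) / q) ^ (-(2 * Δ)) < B := by
      refine hBδ ?_
      have := min_le_left δ ((k : ℝ) / 2)
      rw [Real.dist_eq, abs_lt]; constructor <;> linarith
    have hpk : p ≤ k * q := by
      have : (p : ℝ) < k * q := by rwa [div_lt_iff₀ hq0'] at hhi
      exact_mod_cast this.le
    have hlim : Tendsto (fun m : ℕ => g (p * m) / g (m + 1) / (g (q * (m + 1)) / g (m + 1))) atTop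
        (𝓝 (((p : ℝ) / q) ^ (-(2 * Δ)))) := by
      rw [Real.div_rpow (Nat.cast_nonneg p) (Nat.cast_nonneg q)]
      exact (dil_pred (hP a b) hratio hpos).div ((hP a' b').comp (tendsto_add_atTop_nat 1))
        (Real.rpow_pos_of_pos hq0' _).ne'
    have hev : ∀ᶠ n : ℕ in atTop,
        g (p * (n / q)) / g (n / q + 1) / (g (q * (n / q + 1)) / g (n / q + 1)) < B :=
      (hlim.comp (Nat.tendsto_div_const_atTop hq0.ne')).eventually (gt_mem_nhds hBpq)
    filter_upwards [hev] with n hn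
    rw [div_div_div_cancel_right₀ (hpos _).ne'] at hn
    refine lt_of_le_of_lt
      (div_le_div₀ (hpos _).le (hanti ?_) (hpos _) (hanti (Nat.lt_mul_div_succ n hq0).le)) hn
    calc p * (n / q) ≤ (k * q) * (n / q) := Nat.mul_le_mul_right _ hpk
      _ = k * (q * (n / q)) := by ring
      _ ≤ k * n := Nat.mul_le_mul_left k (Nat.mul_div_le n q)

/-! ## The two exponents agree (antitonicity + rational approximation of `log 3 / log 2`) -/

/-- Limit comparison of the ratio-form laws at `p` (exponent `Δp`) and `q` (exponent `Δq`) along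
`p^a ≤ q^b`: antitonicity gives `Δp·a·log p ≤ Δq·b·log q`. -/
theorem exponent_ineq (hpos : ∀ n, 0 < g n) (hanti : Antitone g) {p q : ℕ} (hp : 0 < p) (hq : 0 < q)
    {Δp Δq : ℝ}
    (hP : Tendsto (fun n : ℕ => g (p * n) / g n) atTop (𝓝 ((p : ℝ) ^ (-(2 * Δp)))))
    (hQ : Tendsto (fun n : ℕ => g (q * n) / g n) atTop (𝓝 ((q : ℝ) ^ (-(2 * Δq)))))
    {a b : ℕ} (hab : p ^ a ≤ q ^ b) :
    Δp * a * Real.log p ≤ Δq * b * Real.log q := by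
  have hA := dil_pow hpos hp hP a
  have hB := dil_pow hpos hq hQ b
  have hle : ((q ^ b : ℕ) : ℝ) ^ (-(2 * Δq)) ≤ ((p ^ a : ℕ) : ℝ) ^ (-(2 * Δp)) :=
    le_of_tendsto_of_tendsto' hB hA fun n =>
      div_le_div_of_nonneg_right (hanti (Nat.mul_le_mul_right n hab)) (hpos n).le
  have hp' : (0 : ℝ) < ((p ^ a : ℕ) : ℝ) := by exact_mod_cast pow_pos hp a
  have hq' : (0 : ℝ) < ((q ^ b : ℕ) : ℝ) := by exact_mod_cast pow_pos hq b
  have hlog := Real.log_le_log (Real.rpow_pos_of_pos hq' _) hle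
  rw [Real.log_rpow hq', Real.log_rpow hp'] at hlog
  simp only [Nat.cast_pow, Real.log_pow] at hlog
  linarith

/-- Archimedes: an interval `(lo, hi)` with `0 ≤ lo < hi` contains a ratio of naturals `a / b`, written
multiplied out. -/
private theorem exists_nat_ratio_btwn {lo hi : ℝ} (hlo : 0 ≤ lo) (h : lo < hi) :
    ∃ a b : ℕ, lo * b < a ∧ (a : ℝ) < hi * b := by
  obtain ⟨b, hb⟩ := exists_nat_gt (1 / (hi - lo))
  have hhl : 0 < hi - lo := by linarith
  refine ⟨⌊lo * b⌋₊ + 1, b, ?_, ?_⟩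
  · push_cast; exact Nat.lt_floor_add_one _
  · push_cast
    have h1 : (⌊lo * b⌋₊ : ℝ) ≤ lo * b := Nat.floor_le (by positivity)
    have h2 : 1 < b * (hi - lo) := by rwa [div_lt_iff₀ hhl] at hb
    nlinarith

/-- **Exponent matching.** For a positive antitone `g`, the dyadic law at `Δ₂` and the triadic law at `Δ₃`
force `Δ₂ = Δ₃` (compare `g(2^a n) ≥ g(3^b n)` for `2^a ≤ 3^b` and let `a/b → log 3 / log 2` from either
side). [folklore] -/
theorem exponent_unique (hpos : ∀ n, 0 < g n) (hanti : Antitone g) {Δ₂ Δ₃ : ℝ}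
    (h2 : Tendsto (fun n : ℕ => g (2 * n) * (2 : ℝ) ^ (2 * Δ₂) / g n) atTop (𝓝 1))
    (h3 : Tendsto (fun n : ℕ => g (3 * n) * (3 : ℝ) ^ (2 * Δ₃) / g n) atTop (𝓝 1)) : Δ₂ = Δ₃ := by
  have hD2 := dil_of_law (g := g) (Δ := Δ₂) two_pos (by exact_mod_cast h2)
  have hD3 := dil_of_law (g := g) (Δ := Δ₃) three_pos (by exact_mod_cast h3)
  have hl2 : 0 < Real.log 2 := Real.log_pos one_lt_two
  have hl3 : 0 < Real.log 3 := Real.log_pos (by norm_num)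
  have I1 : ∀ a b : ℕ, 2 ^ a ≤ 3 ^ b → Δ₂ * a * Real.log 2 ≤ Δ₃ * b * Real.log 3 := by
    intro a b hab
    have := exponent_ineq hpos hanti two_pos three_pos hD2 hD3 hab
    exact_mod_cast this
  have I2 : ∀ a b : ℕ, 3 ^ b ≤ 2 ^ a → Δ₃ * b * Real.log 3 ≤ Δ₂ * a * Real.log 2 := by
    intro a b hab
    have := exponent_ineq hpos hanti three_pos two_pos hD3 hD2 hab
    exact_mod_cast this
  have hΔ3 : 0 ≤ Δ₃ := by
    have := I1 0 1 (by norm_num)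
    simp only [Nat.cast_zero, Nat.cast_one, mul_zero, zero_mul, mul_one] at this
    nlinarith
  have hΔ2 : 0 ≤ Δ₂ := by
    have := I2 1 0 (by norm_num)
    simp only [Nat.cast_zero, Nat.cast_one, mul_zero, zero_mul, mul_one] at this
    nlinarith
  -- `a log x < b log y ⇒ x^a ≤ y^b`
  have pow_le : ∀ {x y : ℕ} {a b : ℕ}, 0 < x → 0 < y →
      (a : ℝ) * Real.log x < b * Real.log y → x ^ a ≤ y ^ b := by
    intro x y a b hx hy hlt
    have hx' : (0 : ℝ) < x := by exact_mod_cast hx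
    have hy' : (0 : ℝ) < y := by exact_mod_cast hy
    have : (x : ℝ) ^ a < (y : ℝ) ^ b := by
      rw [← Real.log_lt_log_iff (pow_pos hx' _) (pow_pos hy' _), Real.log_pow, Real.log_pow]
      exact hlt
    exact_mod_cast this.le
  by_contra hne
  rcases lt_or_gt_of_ne hne with hlt | hlt
  · -- `Δ₂ < Δ₃`: violate `I2` with `a/b` slightly above `log 3 / log 2`
    rcases hΔ2.eq_or_lt with h0 | hΔ2pos
    · have := I2 2 1 (by norm_num)
      simp only [Nat.cast_one, Nat.cast_ofNat, mul_one] at this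
      have h3pos : 0 < Δ₃ := by linarith
      nlinarith [mul_pos h3pos hl3]
    · have hden : 0 < Δ₂ * Real.log 2 := mul_pos hΔ2pos hl2
      obtain ⟨a, b, hlo, hhi⟩ := exists_nat_ratio_btwn (lo := Real.log 3 / Real.log 2)
        (hi := Δ₃ * Real.log 3 / (Δ₂ * Real.log 2)) (div_pos hl3 hl2).le (by
          rw [div_lt_div_iff₀ hl2 hden]
          nlinarith [mul_pos hl2 hl3])
      rw [div_mul_eq_mul_div, div_lt_iff₀ hl2] at hlo
      rw [div_mul_eq_mul_div, lt_div_iff₀ hden] at hhi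
      have hab : 3 ^ b ≤ 2 ^ a := pow_le three_pos two_pos (by push_cast; linarith)
      have := I2 a b hab
      nlinarith
  · -- `Δ₃ < Δ₂`: violate `I1` with `a/b` slightly below `log 3 / log 2`
    have hΔ2pos : 0 < Δ₂ := lt_of_le_of_lt hΔ3 hlt
    have hden : 0 < Δ₂ * Real.log 2 := mul_pos hΔ2pos hl2
    obtain ⟨a, b, hlo, hhi⟩ := exists_nat_ratio_btwn (lo := Δ₃ * Real.log 3 / (Δ₂ * Real.log 2))
      (hi := Real.log 3 / Real.log 2) (div_nonneg (mul_nonneg hΔ3 hl3.le) hden.le) (by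
        rw [div_lt_div_iff₀ hden hl2]
        nlinarith [mul_pos hl2 hl3])
    rw [div_mul_eq_mul_div, div_lt_iff₀ hden] at hlo
    rw [div_mul_eq_mul_div, lt_div_iff₀ hl2] at hhi
    have hab : 2 ^ a ≤ 3 ^ b := pow_le two_pos three_pos (by push_cast; linarith)
    have := I1 a b hab
    nlinarith

/-! ## Glue for the concrete axis two-point function -/

open Literature.Probability.LatticeModels in
/-- **S2 from two dilations (concrete, at fixed exponents).** For `g(n) = ⟨σ₀σ_{ne₀}⟩_{β_c(3)}` on `ℤ³`:
the rate-free dyadic law at `Δ` in the shape of item stmt-CriticalPhenomena-6323 (`4^Δ`) and its triadic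
twin at `Δ'` (`9^{Δ'}`) force `Δ' = Δ` and give the integer dilation law S2 at `Δ` (all `k ≥ 1`). Inputs:
Messager–Miracle-Solé antitonicity `criticalTwoPoint_axis_antitone`, positivity `criticalTwoPoint_axis_pos`,
the unit-step ratio `criticalTwoPoint_axis_ratio_tendsto_one'`, and the two theorems above. [folklore] -/
theorem integerDilationLawAt_of_dyadic_triadic {Δ Δ' : ℝ}
    (h2 : Filter.Tendsto (fun n : ℕ => criticalTwoPoint 3 (Pi.single 0 ((2 * n : ℕ) : ℤ)) * (4 : ℝ) ^ Δ /
      criticalTwoPoint 3 (Pi.single 0 ((n : ℕ) : ℤ))) Filter.atTop (nhds 1))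
    (h3 : Filter.Tendsto (fun n : ℕ => criticalTwoPoint 3 (Pi.single 0 ((3 * n : ℕ) : ℤ)) * (9 : ℝ) ^ Δ' /
      criticalTwoPoint 3 (Pi.single 0 ((n : ℕ) : ℤ))) Filter.atTop (nhds 1)) :
    Δ' = Δ ∧ ∀ k : ℕ, 1 ≤ k → Filter.Tendsto (fun n : ℕ =>
      criticalTwoPoint 3 (Pi.single 0 ((k * n : ℕ) : ℤ)) * (k : ℝ) ^ (2 * Δ) /
        criticalTwoPoint 3 (Pi.single 0 ((n : ℕ) : ℤ))) Filter.atTop (nhds 1) := by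
  have hpos : ∀ n : ℕ, 0 < (fun m : ℕ => criticalTwoPoint 3 (Pi.single 0 (m : ℤ))) n :=
    criticalTwoPoint_axis_pos
  have hanti : Antitone (fun m : ℕ => criticalTwoPoint 3 (Pi.single 0 (m : ℤ))) :=
    criticalTwoPoint_axis_antitone
  have hratio := criticalTwoPoint_axis_ratio_tendsto_one' 0
  have h4 : (4 : ℝ) ^ Δ = (2 : ℝ) ^ (2 * Δ) := by
    rw [Real.rpow_mul (by norm_num), Real.rpow_two]; norm_num
  have h9 : (9 : ℝ) ^ Δ' = (3 : ℝ) ^ (2 * Δ') := by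
    rw [Real.rpow_mul (by norm_num), Real.rpow_two]; norm_num
  rw [h4] at h2; rw [h9] at h3
  obtain rfl : Δ = Δ' := exponent_unique hpos hanti h2 h3
  exact ⟨rfl, integerDilation_of_two_three hpos hanti hratio h2 h3⟩

end TwoDilations

/-- **Two dilations suffice** (registered glue of line `tower_profile_rigidity`, crux
stmt-CriticalPhenomena-0634). For `g(n) = ⟨σ₀σ_{ne₀}⟩_{β_c(3)}` on `ℤ³`: the dyadic scaling law
`∃ Δ > 0, g(2n)·4^Δ/g(n) → 1` (verbatim item stmt-CriticalPhenomena-6323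
`Theses.ThresholdDilation.DyadicScalingLaw`) together with its triadic twin `∃ Δ', g(3n)·9^{Δ'}/g(n) → 1`
implies the integer dilation law S2 `∃ Δ ∀ k ≥ 1, g(kn)·k^{2Δ}/g(n) → 1` (verbatim the registered stub
`stub_integerDilationLaw`), at the dyadic exponent. Sequence form of Feller's criterion for regular
variation of monotone functions (convergence of dilation ratios on a dense set suffices), via
`TwoDilations.integerDilationLawAt_of_dyadic_triadic`. [cite: Feller1971, §VIII.8 Lemma 1] -/
theorem integerDilationLaw_of_dyadicScalingLaw_of_triadicScalingLaw : (∃ Δ : ℝ, 0 < Δ ∧ Filter.Tendsto (fun n : ℕ => Literature.Probability.LatticeModels.criticalTwoPoint 3 (Pi.single 0 ((2 * n : ℕ) : ℤ)) * (4 : ℝ) ^ Δ / Literature.Probability.LatticeModels.criticalTwoPoint 3 (Pi.single 0 ((n : ℕ) : ℤ))) Filter.atTop (nhds 1)) → (∃ Δ' : ℝ, Filter.Tendsto (fun n : ℕ => Literature.Probability.LatticeModels.criticalTwoPoint 3 (Pi.single 0 ((3 * n : ℕ) : ℤ)) * (9 : ℝ) ^ Δ' / Literature.Probability.LatticeModels.criticalTwoPoint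 3 (Pi.single 0 ((n : ℕ) : ℤ))) Filter.atTop (nhds 1)) → ∃ Δ : ℝ, ∀ k : ℕ, 1 ≤ k → Filter.Tendsto (fun n : ℕ => Literature.Probability.LatticeModels.criticalTwoPoint 3 (Pi.single 0 ((k * n : ℕ) : ℤ)) * (k : ℝ) ^ (2 * Δ) / Literature.Probability.LatticeModels.criticalTwoPoint 3 (Pi.single 0 ((n : ℕ) : ℤ))) Filter.atTop (nhds 1) := by
  rintro ⟨Δ, -, h2⟩ ⟨Δ', h3⟩
  exact ⟨Δ, (TwoDilations.integerDilationLawAt_of_dyadic_triadic h2 h3).2⟩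

end Summit.CriticalPhenomena.Ising3DConformalLimit.Cruxes.IsingEuclidUpgradeR2RotInvPowerLaw.TowerProfileRigidity

end
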